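import Summits.Langlands.Langlands.Statement
import Literature.NumberTheory.Automorphic.ACCAutomorphyLiftingCrystalline
import Literature.NumberTheory.Automorphic.PolarizedCompatibleSystemRationalModelsProofs
import HarnessLib

/-!
# F4 `_onpath` — `Langlands → WeightZeroLiftingRamifiedP` (line `WeightZeroLiftingRamifiedP`, crux
# `ReciprocityUpToIrreducibility`, item stmt-Langlands-14328; G4 ladder-down generation 35)

Self-contained, sorry-free: the declarations of §§1–4 of `Lines/WeightZeroLiftingRamifiedP.lean` and the
on-path lemma `WeightZeroLiftingRamifiedP_of_Langlands : Langlands → WeightZeroLiftingRamifiedP`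
(indeed `family_of_langlands : Langlands → WeightZeroLifting θ` for every `θ`): clause (B) of the
summit at any reciprocity datum (one exists by the `Nonempty` conjunct) applies to every `ρ` of the
cell — the cell's local clause is stated against the PINNED Fontaine datum
`fontainePstAdicCompletion v p hv = Rec.pst p v hv` (`rfl`), crystalline ⇒ de Rham ⇒
`IsGeometricFramed Rec ρ`; `Corresponds Rec ι Π ρ` contains a.e. Satake–Frobenius matching in the
summit's normalisation (`m = 1`), and `Π` is L-algebraic (`T ⊗ |det|^0 = T`).
-/

noncomputable section

set_option linter.dupNamespace false

open scoped MatrixGroups Matrix NumberField Classical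
open NumberField IsDedekindDomain Field Filter
open Literature.NumberTheory.Automorphic Literature.NumberTheory.GaloisRepresentations
open Literature.NumberTheory.PAdicHodge
open Summit.Langlands

namespace Summit.Langlands.Langlands.Cruxes.ReciprocityUpToIrreducibility.WeightZeroLiftingRamifiedP

/-! ## 1. The dial clause -/

/-- The **ramification clause** of the dial (the ONE hypothesis that moves): `θ = 0` — `p` is
unramified in `F` (ACC+ Thm 6.1.1 (2), verbatim the tree's fact); `θ ≥ 1` — no condition. -/
def ramClause (F : Type) [Field F] [NumberField F] (p : ℕ) : ℕ → Prop
  | 0 => Algebra.IsUnramifiedIn (𝓞 F) (Ideal.span {(p : ℤ)})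
  | _ + 1 => True

theorem ramClause_zero_iff (F : Type) [Field F] [NumberField F] (p : ℕ) :
    ramClause F p 0 ↔ Algebra.IsUnramifiedIn (𝓞 F) (Ideal.span {(p : ℤ)}) := Iff.rfl

theorem ramClause_succ (F : Type) [Field F] [NumberField F] (p θ : ℕ) :
    ramClause F p (θ + 1) := trivial

/-- The clause only weakens as `θ` grows. -/
theorem ramClause_mono (F : Type) [Field F] [NumberField F] (p : ℕ) {θ θ' : ℕ} (hle : θ ≤ θ')
    (h : ramClause F p θ) : ramClause F p θ' := by
  cases θ' with
  | zero =>
    have : θ = 0 := Nat.le_zero.mp hle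
    subst this; exact h
  | succ k => exact trivial

/-! ## 2. The weight-zero lifting hypotheses, the family, the rung -/

/-- **Local hypothesis at `v ∣ p`** (verbatim from the fact): `ρ|Γ_{F_v}` is crystalline for the
PINNED Fontaine datum with every labelled Hodge–Tate multiset `{0, 1, …, n-1}` (weight zero). -/
def CrystallineWeightZeroAt (F : Type) [Field F] [NumberField F] (n p : ℕ) [Fact p.Prime]
    (ρ : FramedGaloisRep F (PadicAlgCl p) n) : Prop :=
  ∀ (v : HeightOneSpectrum (𝓞 F)) (hv : ((p : ℕ) : 𝓞 F) ∈ v.asIdeal),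
    let D := fontainePstAdicCompletion v p hv
    D.IsCrystallineFramed (ρ.toLocal v) ∧
      (letI := D.algebra
       ∀ τ' : v.adicCompletion F →ₐ[ℚ_[p]] PadicAlgCl p,
         ρ.labelledHodgeTateWeightsAt v D.algebra D.𝔅 τ'.toRingHom =
           (Multiset.range n).map fun i : ℕ => (i : ℤ))

/-- **Residual hypotheses and weight-zero seed** (verbatim from the fact): `τ = ρ̄` absolutely
irreducible, decomposed generic, absolutely irreducible on `Γ_{F(ζ_p)}` with enormous image, a scalar
`ρ̄(σ)` with `σ ∉ Γ_{F(ζ_p)}`; a cuspidal `π` of weight zero, unramified above `p`, HLTT-compatible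
with some `r ≡ ρ (mod 𝔪)`.  NO hypothesis relating `ρ|Γ_{F_v}` and `r|Γ_{F_v}` at `v ∣ p`. -/
def ResidualSeed (F : Type) [Field F] [NumberField F] (n : ℕ)
    (hcpt : isCompact_glFiniteIntegralLevel n F) (p : ℕ) [Fact p.Prime] (ι : PadicAlgCl p ≃+* ℂ)
    (ρ : FramedGaloisRep F (PadicAlgCl p) n)
    (τ : absoluteGaloisGroup F →* GL (Fin n) (padicAlgClResidueField p))
    (π : CuspidalAutomorphicRepData n F hcpt) (r : FramedGaloisRep F (PadicAlgCl p) n) : Prop :=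
  ρ.IsResidualRepOf (RingHom.id _) τ ∧ IsAbsIrreducible τ ∧ IsDecomposedGeneric τ ∧
    IsAbsIrreducible (τ.comp (absGaloisGroupAdjoinRootsOfUnity F p).subtype) ∧
    Subgroup.IsEnormous ((absGaloisGroupAdjoinRootsOfUnity F p).map τ) ∧
    (∃ σ : absoluteGaloisGroup F, σ ∉ absGaloisGroupAdjoinRootsOfUnity F p ∧
      ∃ c : padicAlgClResidueField p,
        ((τ σ : GL (Fin n) (padicAlgClResidueField p)) :
          Matrix (Fin n) (Fin n) (padicAlgClResidueField p)) = c • (1 : Matrix _ _ _)) ∧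
    π.1.HasWeightZero ∧ HLTT.IsCompatible π.1 ι r ∧ r.IsResidualRepOf (RingHom.id _) τ ∧
    (∀ v : HeightOneSpectrum (𝓞 F), ((p : ℕ) : 𝓞 F) ∈ v.asIdeal → π.1.IsUnramifiedAt v)

/-- **Conclusion shape** (automorphy up to the normalisation twist): a cuspidal `Π` of
`GL_n(𝔸_F)` and `m : ℕ` with `Π ⊗ |det|^{(1-m)/2}` L-algebraic and
`char ρ(Frob_v) = arithFrobPolyOfSatake ι q_v m (Satake Π_v)` at almost every `v`
(`m = n`: `ρ ≅ r_ι(Π)`, HLTT; `m = 1`: the summit's `SatakeFrobCompatibleAt`). -/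
def AutomorphicAE (F : Type) [Field F] [NumberField F] (n : ℕ)
    (hcpt : isCompact_glFiniteIntegralLevel n F) (p : ℕ) [Fact p.Prime] (ι : PadicAlgCl p ≃+* ℂ)
    (ρ : FramedGaloisRep F (PadicAlgCl p) n) : Prop :=
  ∃ (Pi : CuspidalAutomorphicRepData n F hcpt) (m : ℕ),
    (∃ T : InfinityType F n, Pi.1.HasInfinityType T ∧ (T.twist ((1 - (m : ℂ)) / 2)).IsLAlgebraic) ∧
    ∀ᶠ v : HeightOneSpectrum (𝓞 F) in cofinite, ∃ α : Multiset ℂ,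
      Pi.1.HasSatakeParamAt v α ∧ ρ.IsUnramifiedAt v ∧
        ρ.HasFrobCharpolyAt v (arithFrobPolyOfSatake ι v.residueCard m α)

/-- **The rung family** `E(θ)`: weight-zero crystalline automorphy lifting for `GL_n` over CM /
totally real `F`, `p > n²`, `p > 2n`, ramification clause `ramClause θ`, for irreducible a.e.-unramified
`ρ` crystalline of weight zero above `p` with residual hypotheses and a weight-zero seed.
`θ = 0` IN THE TREE (ACC+ 6.1.1); `θ ≥ 1` OPEN (BCGNT Thm 3.2.1 minus its connectedness (5c)).
[cite: AllenEtAl2023, Thm. 6.1.1] [cite: arXiv:2309.15880, Thm. 3.2.1, Rem. 3.2.2]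
[cite: arXiv:2301.10509, Thm. 5.2, Rem. 5.2.3] -/
def WeightZeroLifting (θ : ℕ) : Prop :=
  ∀ (F : Type) [Field F] [NumberField F], IsTotallyReal F ∨ IsCMField F →
    ∀ (n : ℕ) (hcpt : isCompact_glFiniteIntegralLevel n F) (p : ℕ) [Fact p.Prime],
      0 < n → n ^ 2 < p → 2 * n < p → ramClause F p θ →
    ∀ (ι : PadicAlgCl p ≃+* ℂ) (ρ : FramedGaloisRep F (PadicAlgCl p) n)
      (τ : absoluteGaloisGroup F →* GL (Fin n) (padicAlgClResidueField p))
      (π : CuspidalAutomorphicRepData n F hcpt) (r : FramedGaloisRep F (PadicAlgCl p) n),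
      ρ.toGaloisRep.IsIrreducible →
      (∀ᶠ v : HeightOneSpectrum (𝓞 F) in cofinite, ρ.IsUnramifiedAt v) →
      CrystallineWeightZeroAt F n p ρ → ResidualSeed F n hcpt p ι ρ τ π r →
      AutomorphicAE F n hcpt p ι ρ

/-- **THE RUNG** (the filed statement): the family at `θ = 1` — weight-zero crystalline automorphy
lifting for `GL_n` over CM / totally real `F` with `p` ARBITRARILY RAMIFIED in `F` and no
connectedness hypothesis at `v ∣ p`.  OPEN. -/
def WeightZeroLiftingRamifiedP : Prop := WeightZeroLifting 1

theorem rung_iff_family_one : WeightZeroLiftingRamifiedP ↔ WeightZeroLifting 1 := Iff.rfl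

/-! ## 3. (F2) Monotonicity: a higher cell implies every lower cell -/

theorem mono {θ θ' : ℕ} (hle : θ ≤ θ') (h : WeightZeroLifting θ') : WeightZeroLifting θ := by
  intro F _ _ hF n hcpt p _ hn hn2 h2n hram
  exact h F hF n hcpt p hn hn2 h2n (ramClause_mono F p hle hram)

/-- Every cell `θ ≥ 1` is the rung (the dial is constant from `θ = 1` on). -/
theorem family_succ_iff (θ : ℕ) : WeightZeroLifting (θ + 1) ↔ WeightZeroLiftingRamifiedP := by
  constructor
  · exact fun h => mono (by omega) h
  · intro h F _ _ hF n hcpt p _ hn hn2 h2n _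
    exact h F hF n hcpt p hn hn2 h2n trivial

theorem floor_of_rung (h : WeightZeroLiftingRamifiedP) : WeightZeroLifting 0 := mono (by omega) h

/-! ## 4. (F3) Floor: `θ = 0` is the tree's named fact ACC+ Thm 6.1.1 (weight zero) -/

/-- The weight-zero infinity type twisted by `|det|^{(1-n)/2}` is L-algebraic. -/
theorem isLAlgebraic_twist_weightZero (n : ℕ) (F : Type) [Field F] :
    ((weightZeroInfinityType n F).twist ((1 - (n : ℂ)) / 2)).IsLAlgebraic := by
  intro σ q hq
  simp only [InfinityType.twist_apply, weightZeroInfinityType_apply, Multiset.map_map,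
    Function.comp_def, Multiset.mem_map, Finset.mem_val, Finset.mem_univ, true_and] at hq
  obtain ⟨i, rfl⟩ := hq
  refine ⟨-((i : ℕ) : ℤ), ((i : ℕ) : ℤ) + 1 - n, ?_, ?_⟩
  · simp [rhoGL]; ring
  · simp [rhoGL]; ring

/-- **FLOOR** `θ = 0` from the named fact (binders verbatim; `m = n`, `Π` of weight zero; a.e.
Satake matching from HLTT-compatibility and Flath). -/
theorem floor_zero (hACC : ACCGHLNSTT2023.automorphyLifting_crystalline_weightZero) :
    WeightZeroLifting 0 := by
  intro F _ _ hF n hcpt p _ hn hn2 h2n hram ι ρ τ π r _hirr hunr hloc hseed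
  obtain ⟨hres, hτ, hdg, hζ, henorm, hσ, hπ0, hcomp, hresr, hπp⟩ := hseed
  obtain ⟨Pi, hPi0, hc, -, -⟩ := hACC F hF n hcpt p hn2 h2n hram ι ρ τ π r hunr hloc hres hτ hdg
    hζ henorm hσ hπ0 hcomp hresr hπp
  refine ⟨Pi, n, ⟨weightZeroInfinityType n F, hPi0, isLAlgebraic_twist_weightZero n F⟩, ?_⟩
  have hae := eventually_isGaloisCompatibleAt_of_isCompatible Pi (ι := ι) (r := ρ) hc
  have hcof : ∀ᶠ v : HeightOneSpectrum (𝓞 F) in cofinite, ∃ α : Multiset ℂ,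
      Pi.1.HasSatakeParamAt v α := Pi.1.hasSatakeParamAt_cofinite_holds
  filter_upwards [hae, hcof] with v h1 ⟨α, hα⟩
  exact ⟨α, hα, (h1 α hα).1, (h1 α hα).2⟩

/-- F3 witness shape: the floor cell by `simpa` from the floor lemma. -/
example (h : ACCGHLNSTT2023.automorphyLifting_crystalline_weightZero) : WeightZeroLifting 0 := by
  simpa using floor_zero h

/-! ## 8. The rung is a consequence of the top and of the summit (sorry-free) -/

theorem twist_zero' {F : Type} [Field F] {n : ℕ} (T : InfinityType F n) : T.twist 0 = T := by
  funext σ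
  simp [InfinityType.twist]

/-- Clause (B) at SOME datum for every `F` gives every cell: the local clause of the cell is stated
against the PINNED Fontaine datum `fontainePstAdicCompletion v p hv = Rec.pst p v hv` (`rfl`),
crystalline ⇒ de Rham, so `IsGeometricFramed Rec ρ`; `Corresponds Rec ι Π ρ` contains a.e.
Satake–Frobenius matching with `m = 1`, and `Π` is L-algebraic (`T ⊗ |det|^0 = T`). -/
theorem family_of_clauseB (θ : ℕ)
    (hB : ∀ (F : Type) [Field F] [NumberField F], ∃ Rec : ReciprocityData F,
      ∀ n : ℕ, 0 < n → ∀ hcpt : isCompact_glFiniteIntegralLevel n F, GaloisToAutomorphic n Rec hcpt) :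
    WeightZeroLifting θ := by
  intro F _ _ _hF n hcpt p _ hn _hn2 _h2n _hram ι ρ τ π r hirr hunr hloc _hseed
  obtain ⟨Rec, hall⟩ := hB F
  have hBn : GaloisToAutomorphic n Rec hcpt := hall n hn hcpt
  have hdR : ∀ (v : HeightOneSpectrum (𝓞 F)) (hv : ((p : ℕ) : 𝓞 F) ∈ v.asIdeal),
      (Rec.pst p v hv).IsDeRhamFramed (ρ.toLocal v) := by
    intro v hv
    change (fontainePstAdicCompletion v p hv).IsDeRhamFramed (ρ.toLocal v)
    exact (hloc v hv).1.isDeRhamFramed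
  have hgeo : IsGeometricFramed Rec ρ := ⟨hunr, hdR⟩
  obtain ⟨Pi, ⟨T, hT, hTL⟩, hcorr⟩ := hBn p ι ρ hirr hgeo
  refine ⟨Pi, 1, ⟨T, hT, ?_⟩, ?_⟩
  · have h0 : ((1 - ((1 : ℕ) : ℂ)) / 2) = 0 := by norm_num
    rw [h0, twist_zero']
    exact hTL
  · exact hcorr.1

/-- `Langlands → every cell`. -/
theorem family_of_langlands (θ : ℕ) (hL : _root_.Langlands) : WeightZeroLifting θ :=
  family_of_clauseB θ fun F _ _ => by
    obtain ⟨⟨Rec⟩, hall⟩ := hL F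
    exact ⟨Rec, fun n hn hcpt => (hall Rec n hn hcpt).2⟩

/-- **F4 on-path lemma for the rung**: `Langlands → WeightZeroLiftingRamifiedP`. -/
@[aesop safe apply]
theorem WeightZeroLiftingRamifiedP_of_Langlands (hL : _root_.Langlands) :
    WeightZeroLiftingRamifiedP :=
  family_of_langlands 1 hL

example : _root_.Langlands → WeightZeroLiftingRamifiedP := by intro h; aesop

end Summit.Langlands.Langlands.Cruxes.ReciprocityUpToIrreducibility.WeightZeroLiftingRamifiedP

end
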